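import Mathlib
import Literature.NumberTheory.LFunctions.NicolasSqrtAverage
import Literature.NumberTheory.LFunctions.ZetaZeroReciprocalSum
import Literature.NumberTheory.LFunctions.RosserSchoenfeldMertensFirstConstantCorollaries
import Literature.NumberTheory.Transcendental.ZetaLinearFormsCriterion
import HarnessLib

/-!
# The explicit formula for the logarithmic Riesz mean `W(X) = ∫₁^X ψ(t)dt/t`

Helper file (`--supports stmt-RiemannHypothesis-0098`, lead-track anchor: Weil-positivity window ladder, format-C far bound),
pure proofs, imports only `Literature`.  Seat rh-explicit-weil-1 gen10 (memo `run/shared/lean/pub/rh-explicit/rh-explicit-weil-1/FORMAT-K3.md` §11).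
STRUCTURE.md law C-XIII for the far-coercivity floor reads `λ_max(a) = L(a) − 2γ_E + ε(a)`, `L = pntFloor`, `ε` bounded; the
floor's near-extremizer `χ_a = cosh(·/2)·1_{[−a,a]}` (`WeilFarFloorCoshTest`) has Rayleigh numerator
`e^a M(e^{2a}) − e^{−a}ψ(e^{2a}) + ½W(e^{2a}) + ½Σ_{n≤e^{2a}}Λ(n)(2a − log n)/n` with `W(X) = Σ_{n≤X}Λ(n)log(X/n) = ∫₁^X ψ(t)dt/t`.
Here: §1 `W(X) = ψ₁(X)/X + ∫₁^X ψ₁/t²` (right-derivative FTC); §2 from the tree's absolutely convergent explicit formula for `ψ₁`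
(`Literature.NumberTheory.LFunctions.psiOne_eq_explicit`, Montgomery–Vaughan (13.7)), `∫₁^X Σ_ρ = Σ_ρ ∫₁^X` (dominated convergence) and
the telescoping `1/(ρ(ρ+1)) + 1/(ρ²(ρ+1)) = 1/ρ²`:
**`W(X) = X − Re Σ_ρ m(ρ)X^ρ/ρ² − (log 2π)·log X + c₀ + (Re E(X)/X + Re ∫₁^X E/t²)`** (`logRiesz_explicit`; UNCONDITIONAL, the sum
over the non-trivial zeros with multiplicity converging absolutely; `c₀ = −½ − log 2π + Re Σ_ρ m(ρ)/(ρ²(ρ+1))`, `‖E(x)‖ ≤ C√x`), hence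
**`|W(X) − X + Re Σ_ρ m(ρ)X^ρ/ρ² + (log 2π) log X| ≤ C'`** for all `X ≥ 1` (`exists_abs_logRiesz_sub_le`).  The companion file
`WeilFarFloorCoshZeroSum` derives from this the law's constant `−2γ_E` and its oscillating zero-sum residual for the cosh test.
Standard axioms only.
-/

set_option linter.dupNamespace false
set_option autoImplicit false

noncomputable section

open MeasureTheory Set Filter Topology intervalIntegral Complex
open scoped Real BigOperators ArithmeticFunction.vonMangoldt Chebyshev

namespace Summit.RiemannHypothesis.RiemannHypothesis.Theorems.WeilFormatC

namespace LogRieszExplicit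

open Literature.NumberTheory.LFunctions NicolasJ NicolasJExplicit NicolasSqrtAverage

/-! ## §1 `W(X) = ∫₁^X ψ(t)dt/t` through `ψ₁ = ∫ψ` -/

/-- **`∫_{(1,X]} ψ(t)/t dt = ψ₁(X)/X + ∫_{(1,X]} ψ₁(t)/t² dt`** for `X ≥ 1` (`ψ₁(t) = Σ_{n≤t} Λ(n)(t − n) = ∫₀ᵗ ψ`;
right-derivative FTC with `(ψ₁/t)' = ψ/t − ψ₁/t²`). -/
theorem logRiesz_eq_psiOne {X : ℝ} (hX : 1 ≤ X) :
    ∫ t in Ioc 1 X, t⁻¹ * ψ t = psiOne X / X + ∫ t in Ioc 1 X, psiOne t / t ^ 2 := by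
  have hderiv : ∀ t ∈ Ioo (min 1 X) (max 1 X),
      HasDerivWithinAt (fun t ↦ psiOne t / t) (ψ t / t - psiOne t / t ^ 2) (Ioi t) t := by
    intro t ht
    rw [min_eq_left hX, max_eq_right hX] at ht
    have ht0 : t ≠ 0 := by linarith [ht.1]
    refine ((hasDerivWithinAt_psiOne t).div ((hasDerivAt_id t).hasDerivWithinAt) ht0).congr_deriv ?_
    simp only [id]
    field_simp
  have hcont : ContinuousOn (fun t ↦ psiOne t / t) (uIcc 1 X) := by
    refine continuous_psiOne.continuousOn.div continuousOn_id fun t ht ↦ ?_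
    rw [uIcc_of_le hX] at ht
    exact (show (0 : ℝ) < t by linarith [ht.1]).ne'
  have hint1 : IntervalIntegrable (fun t ↦ ψ t / t) volume 1 X := by
    refine ((intervalIntegrable_psi 1 X).mul_continuousOn (f := ψ) (g := fun t : ℝ ↦ t⁻¹)
      (continuousOn_inv₀.mono fun t ht ↦ ?_)).congr fun t _ ↦ by simp only [div_eq_mul_inv]
    rw [uIcc_of_le hX] at ht
    simp only [mem_compl_iff, mem_singleton_iff]; linarith [ht.1]
  have hint2 : IntervalIntegrable (fun t ↦ psiOne t / t ^ 2) volume 1 X := by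
    refine (continuous_psiOne.continuousOn.div (continuousOn_pow 2) fun t ht ↦ ?_).intervalIntegrable
    rw [uIcc_of_le hX] at ht
    exact pow_ne_zero 2 (by linarith [ht.1])
  have h := intervalIntegral.integral_eq_sub_of_hasDeriv_right hcont hderiv (hint1.sub hint2)
  rw [intervalIntegral.integral_sub hint1 hint2, intervalIntegral.integral_of_le hX,
    intervalIntegral.integral_of_le hX, show psiOne 1 = 0 by simp [psiOne], zero_div, sub_zero] at h
  rw [show ∫ t in Ioc 1 X, t⁻¹ * ψ t = ∫ t in Ioc 1 X, ψ t / t from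
    setIntegral_congr_fun measurableSet_Ioc fun t _ ↦ by rw [div_eq_mul_inv, mul_comm]]
  linarith

/-! ## §2 The explicit formula for `W` -/

/-! ### The zero sums -/

/-- `Σ_ρ m(ρ)/|ρ|² < ∞` over the non-trivial zeros (from `Σ_ρ m(ρ)/(1 + γ²) < ∞` and the gap `|Im ρ| ≥ 2δ`). -/
theorem summable_zeroOrder_div_norm_sq :
    Summable fun ρ : Zeros ↦ (riemannZetaZeroOrder (ρ : ℂ) : ℝ) / ‖(ρ : ℂ)‖ ^ 2 := by
  obtain ⟨δ, hδ, -, hgap⟩ := ZetaZeroSum.exists_gap_im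
  refine Summable.of_nonneg_of_le (fun ρ ↦ div_nonneg (zeroOrder_nonneg' ρ) (sq_nonneg _))
    (fun ρ ↦ ?_) (ZetaZeroSum.summable_zeroOrder_div_one_add_sq.mul_left (1 + 1 / (4 * δ ^ 2)))
  have hm := zeroOrder_nonneg' ρ
  have hg := hgap _ ρ.2
  have him : 4 * δ ^ 2 ≤ (ρ : ℂ).im ^ 2 := by nlinarith [abs_nonneg ((ρ : ℂ)).im, sq_abs ((ρ : ℂ)).im]
  have hn : (ρ : ℂ).im ^ 2 ≤ ‖(ρ : ℂ)‖ ^ 2 := by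
    rw [← sq_abs]
    exact pow_le_pow_left₀ (abs_nonneg _) (Complex.abs_im_le_norm _) 2
  have hpos : 0 < ‖(ρ : ℂ)‖ ^ 2 := by nlinarith
  rw [mul_div_assoc', div_le_div_iff₀ hpos (by positivity)]
  have : (1 + (ρ : ℂ).im ^ 2) ≤ (1 + 1 / (4 * δ ^ 2)) * ‖(ρ : ℂ)‖ ^ 2 := by
    rw [add_mul, one_mul, div_mul_eq_mul_div, one_mul]
    have h1 : 1 ≤ ‖(ρ : ℂ)‖ ^ 2 / (4 * δ ^ 2) := by rw [le_div_iff₀ (by positivity)]; linarith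
    linarith
  calc (riemannZetaZeroOrder (ρ : ℂ) : ℝ) * (1 + (ρ : ℂ).im ^ 2)
      ≤ (riemannZetaZeroOrder (ρ : ℂ) : ℝ) * ((1 + 1 / (4 * δ ^ 2)) * ‖(ρ : ℂ)‖ ^ 2) :=
        mul_le_mul_of_nonneg_left this hm
    _ = (1 + 1 / (4 * δ ^ 2)) * (riemannZetaZeroOrder (ρ : ℂ) : ℝ) * ‖(ρ : ℂ)‖ ^ 2 := by ring

/-- **`Σ_ρ ‖m(ρ) X^ρ/ρ²‖ < ∞`** for `X ≥ 1` (each term is at most `X·m(ρ)/|ρ|²`; unconditional). -/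
theorem summable_norm_zeroOrder_mul_cpow_div_sq {X : ℝ} (hX : 1 ≤ X) :
    Summable fun ρ : Zeros ↦ ‖(riemannZetaZeroOrder (ρ : ℂ) : ℂ) * ((X : ℂ) ^ (ρ : ℂ) / (ρ : ℂ) ^ 2)‖ := by
  refine Summable.of_nonneg_of_le (fun _ ↦ norm_nonneg _) (fun ρ ↦ ?_) (summable_zeroOrder_div_norm_sq.mul_left X)
  have hX0 : 0 < X := by linarith
  rw [norm_mul, Complex.norm_intCast, abs_of_nonneg (zeroOrder_nonneg' ρ), norm_div, norm_pow,
    Complex.norm_cpow_eq_rpow_re_of_pos hX0]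
  have hle : X ^ ((ρ : ℂ)).re ≤ X := by
    conv_rhs => rw [← Real.rpow_one X]
    exact Real.rpow_le_rpow_of_exponent_le hX (re_lt_one ρ.2).le
  have hρ0 : 0 < ‖(ρ : ℂ)‖ ^ 2 := by positivity [norm_pos_iff.2 (ne_zero ρ.2)]
  calc (riemannZetaZeroOrder (ρ : ℂ) : ℝ) * (X ^ ((ρ : ℂ)).re / ‖(ρ : ℂ)‖ ^ 2)
      ≤ (riemannZetaZeroOrder (ρ : ℂ) : ℝ) * (X / ‖(ρ : ℂ)‖ ^ 2) :=
        mul_le_mul_of_nonneg_left (div_le_div_of_nonneg_right hle hρ0.le) (zeroOrder_nonneg' ρ)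
    _ = X * ((riemannZetaZeroOrder (ρ : ℂ) : ℝ) / ‖(ρ : ℂ)‖ ^ 2) := by ring

/-- `Σ_ρ ‖m(ρ)/(ρ²(ρ+1))‖ < ∞` (each term is at most `m(ρ)/|ρ|²`, as `|ρ + 1| ≥ 1`). -/
theorem summable_norm_zeroOrder_div_sq_mul :
    Summable fun ρ : Zeros ↦ ‖(riemannZetaZeroOrder (ρ : ℂ) : ℂ) / ((ρ : ℂ) ^ 2 * (ρ + 1))‖ := by
  refine Summable.of_nonneg_of_le (fun _ ↦ norm_nonneg _) (fun ρ ↦ ?_) summable_zeroOrder_div_norm_sq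
  rw [norm_div, Complex.norm_intCast, abs_of_nonneg (zeroOrder_nonneg' ρ), norm_mul, norm_pow]
  have h1 : 1 ≤ ‖(ρ : ℂ) + 1‖ := by
    have := Complex.re_le_norm ((ρ : ℂ) + 1)
    rw [add_re, one_re] at this
    linarith [re_pos ρ.2]
  have hρ0 : 0 < ‖(ρ : ℂ)‖ ^ 2 := by positivity [norm_pos_iff.2 (ne_zero ρ.2)]
  refine div_le_div_of_nonneg_left (zeroOrder_nonneg' ρ) hρ0 ?_
  nlinarith

/-! ### `∫₁^X Z(t)/t² dt` term by term -/

/-- `∫_{(1,X]} t^{ρ+1}/t² dt = (X^ρ − 1)/ρ` for a non-trivial zero `ρ` (`X ≥ 1`). -/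
theorem integral_cpow_div_sq (ρ : Zeros) {X : ℝ} (hX : 1 ≤ X) :
    ∫ t in Ioc 1 X, (t : ℂ) ^ ((ρ : ℂ) + 1) / (t : ℂ) ^ 2 = ((X : ℂ) ^ (ρ : ℂ) - 1) / (ρ : ℂ) := by
  have hre := re_pos ρ.2
  have heq : EqOn (fun t : ℝ ↦ (t : ℂ) ^ ((ρ : ℂ) + 1) / (t : ℂ) ^ 2) (fun t : ℝ ↦ (t : ℂ) ^ ((ρ : ℂ) - 1)) (Ioc 1 X) := by
    intro t ht
    have ht0 : (t : ℂ) ≠ 0 := Complex.ofReal_ne_zero.2 (by linarith [ht.1] : t ≠ 0)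
    simp only
    rw [show (ρ : ℂ) + 1 = ((ρ : ℂ) - 1) + 2 by ring, Complex.cpow_add _ _ ht0,
      show ((2 : ℂ)) = ((2 : ℕ) : ℂ) by norm_num, Complex.cpow_natCast, mul_div_assoc, div_self (pow_ne_zero 2 ht0), mul_one]
  rw [setIntegral_congr_fun measurableSet_Ioc heq, ← intervalIntegral.integral_of_le hX,
    integral_cpow (Or.inl (by rw [sub_re, one_re]; linarith))]
  simp only [sub_add_cancel, Complex.ofReal_one, Complex.one_cpow]

/-- The `ρ`-th term of `Z(t)/t²` is integrable on `(1, X]`. -/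
theorem integrableOn_zeroTerm_div_sq (ρ : Zeros) (X : ℝ) :
    IntegrableOn (fun t : ℝ ↦ zeroTerm ρ t / (t : ℂ) ^ 2) (Ioc 1 X) := by
  have hc : ContinuousOn (fun t : ℝ ↦ zeroTerm ρ t / (t : ℂ) ^ 2) (Icc 1 X) := by
    refine ContinuousOn.div ?_ (by fun_prop) fun t ht ↦ pow_ne_zero 2 (Complex.ofReal_ne_zero.2 (by linarith [ht.1]))
    have h : Continuous fun t : ℝ ↦ (t : ℂ) ^ ((ρ : ℂ) + 1) :=
      continuous_ofReal_cpow_const (by rw [add_re, one_re]; linarith [re_pos ρ.2])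
    exact (continuous_const.mul (h.div_const _)).continuousOn
  exact hc.integrableOn_Icc.mono_set Ioc_subset_Icc_self

/-- `∫_{(1,X]} zeroTerm ρ t/t² dt = m(ρ)(X^ρ − 1)/(ρ²(ρ+1))`. -/
theorem integral_zeroTerm_div_sq (ρ : Zeros) {X : ℝ} (hX : 1 ≤ X) :
    ∫ t in Ioc 1 X, zeroTerm ρ t / (t : ℂ) ^ 2
      = (riemannZetaZeroOrder (ρ : ℂ) : ℂ) * (((X : ℂ) ^ (ρ : ℂ) - 1) / ((ρ : ℂ) ^ 2 * (ρ + 1))) := by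
  have hρ := ne_zero ρ.2
  have hρ1 := add_one_ne_zero ρ.2
  have heq : EqOn (fun t : ℝ ↦ zeroTerm ρ t / (t : ℂ) ^ 2)
      (fun t : ℝ ↦ (riemannZetaZeroOrder (ρ : ℂ) : ℂ) / ((ρ : ℂ) * (ρ + 1)) * ((t : ℂ) ^ ((ρ : ℂ) + 1) / (t : ℂ) ^ 2))
      (Ioc 1 X) := fun t _ ↦ by simp only [zeroTerm]; ring
  rw [setIntegral_congr_fun measurableSet_Ioc heq, MeasureTheory.integral_const_mul, integral_cpow_div_sq ρ hX]
  field_simp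

/-- `‖zeroTerm ρ t/t²‖ ≤ ‖zeroTerm ρ 1‖ = m(ρ)/|ρ(ρ+1)|` on `[1, ∞)`. -/
theorem norm_zeroTerm_div_sq_le (ρ : Zeros) {t : ℝ} (ht : 1 ≤ t) :
    ‖zeroTerm ρ t / (t : ℂ) ^ 2‖ ≤ ‖zeroTerm ρ 1‖ := by
  have ht0 : 0 < t := by linarith
  rw [norm_div, norm_pow, Complex.norm_real, Real.norm_eq_abs, abs_of_pos ht0, zeroTerm, zeroTerm, norm_mul, norm_mul,
    norm_div, norm_div, Complex.norm_cpow_eq_rpow_re_of_pos ht0, Complex.ofReal_one, Complex.one_cpow, norm_one, add_re, one_re]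
  have hm : 0 ≤ ‖(riemannZetaZeroOrder (ρ : ℂ) : ℂ)‖ := norm_nonneg _
  have hden : 0 < ‖(ρ : ℂ) * (ρ + 1)‖ := norm_pos_iff.2 (mul_ne_zero (ne_zero ρ.2) (add_one_ne_zero ρ.2))
  have hpow : t ^ (((ρ : ℂ)).re + 1) ≤ t ^ 2 := by
    rw [show (t ^ 2 : ℝ) = t ^ (2 : ℝ) by norm_cast]
    exact Real.rpow_le_rpow_of_exponent_le ht (by linarith [re_lt_one ρ.2])
  rw [div_le_iff₀ (by positivity : (0 : ℝ) < t ^ 2)]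
  calc ‖(riemannZetaZeroOrder (ρ : ℂ) : ℂ)‖ * (t ^ (((ρ : ℂ)).re + 1) / ‖(ρ : ℂ) * (ρ + 1)‖)
      ≤ ‖(riemannZetaZeroOrder (ρ : ℂ) : ℂ)‖ * (t ^ 2 / ‖(ρ : ℂ) * (ρ + 1)‖) :=
        mul_le_mul_of_nonneg_left (div_le_div_of_nonneg_right hpow hden.le) hm
    _ = ‖(riemannZetaZeroOrder (ρ : ℂ) : ℂ)‖ * (1 / ‖(ρ : ℂ) * (ρ + 1)‖) * t ^ 2 := by ring

/-- **`∫_{(1,X]} Z(t)/t² dt = Σ_ρ m(ρ)(X^ρ − 1)/(ρ²(ρ+1))`** (dominated convergence: the terms are bounded by `m(ρ)/|ρ(ρ+1)|` on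
`[1, X]`, a summable family). -/
theorem integral_Zsum_div_sq {X : ℝ} (hX : 1 ≤ X) :
    ∫ t in Ioc 1 X, Zsum t / (t : ℂ) ^ 2
      = ∑' ρ : Zeros, (riemannZetaZeroOrder (ρ : ℂ) : ℂ) * (((X : ℂ) ^ (ρ : ℂ) - 1) / ((ρ : ℂ) ^ 2 * (ρ + 1))) := by
  have hsum : Summable fun ρ : Zeros ↦ ∫ t in Ioc 1 X, ‖zeroTerm ρ t / (t : ℂ) ^ 2‖ := by
    refine Summable.of_nonneg_of_le (fun ρ ↦ integral_nonneg fun t ↦ norm_nonneg _) (fun ρ ↦ ?_)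
      ((summable_norm_psiOne_zeroTerm le_rfl).mul_left (X - 1))
    calc ∫ t in Ioc 1 X, ‖zeroTerm ρ t / (t : ℂ) ^ 2‖ ≤ ∫ t in Ioc 1 X, ‖zeroTerm ρ 1‖ :=
          setIntegral_mono_on (integrableOn_zeroTerm_div_sq ρ X).norm (by exact integrableOn_const (by simp))
            measurableSet_Ioc fun t ht ↦ norm_zeroTerm_div_sq_le ρ ht.1.le
      _ = (X - 1) * ‖zeroTerm ρ 1‖ := by
          rw [setIntegral_const, smul_eq_mul, measureReal_def, Real.volume_Ioc, ENNReal.toReal_ofReal (by linarith)]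
  have h := integral_tsum_of_summable_integral_norm (μ := volume.restrict (Ioc 1 X))
    (F := fun (ρ : Zeros) (t : ℝ) ↦ zeroTerm ρ t / (t : ℂ) ^ 2) (fun ρ ↦ integrableOn_zeroTerm_div_sq ρ X) hsum
  have hlhs : ∫ t in Ioc 1 X, Zsum t / (t : ℂ) ^ 2 = ∫ t in Ioc 1 X, ∑' ρ : Zeros, zeroTerm ρ t / (t : ℂ) ^ 2 := by
    refine integral_congr_ae (ae_of_all _ fun t ↦ ?_)
    simp only [Zsum, div_eq_mul_inv]
    exact tsum_mul_right.symm
  rw [hlhs, ← h]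
  exact tsum_congr fun ρ ↦ integral_zeroTerm_div_sq ρ hX

/-- **Telescoping of the two zero sums**: `Z(X)/X + Σ_ρ m(ρ)(X^ρ − 1)/(ρ²(ρ+1)) = Σ_ρ m(ρ)X^ρ/ρ² − Σ_ρ m(ρ)/(ρ²(ρ+1))`
(`1/(ρ(ρ+1)) + 1/(ρ²(ρ+1)) = 1/ρ²`; all four series converge absolutely). -/
theorem Zsum_div_add_tsum {X : ℝ} (hX : 1 ≤ X) :
    Zsum X / X + ∑' ρ : Zeros, (riemannZetaZeroOrder (ρ : ℂ) : ℂ) * (((X : ℂ) ^ (ρ : ℂ) - 1) / ((ρ : ℂ) ^ 2 * (ρ + 1)))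
      = ∑' ρ : Zeros, (riemannZetaZeroOrder (ρ : ℂ) : ℂ) * ((X : ℂ) ^ (ρ : ℂ) / (ρ : ℂ) ^ 2)
        - ∑' ρ : Zeros, (riemannZetaZeroOrder (ρ : ℂ) : ℂ) / ((ρ : ℂ) ^ 2 * (ρ + 1)) := by
  have hX0 : (X : ℂ) ≠ 0 := Complex.ofReal_ne_zero.2 (by linarith)
  have hs1 : Summable fun ρ : Zeros ↦ zeroTerm ρ X / X := (summable_zeroTerm hX).div_const _
  have hs3n := summable_norm_zeroOrder_mul_cpow_div_sq hX
  have hs3 := hs3n.of_norm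
  have hs4 := summable_norm_zeroOrder_div_sq_mul.of_norm
  -- `Σ m X^ρ/(ρ²(ρ+1))` converges absolutely (`|ρ + 1| ≥ 1`)
  have hs5n : Summable fun ρ : Zeros ↦ ‖(riemannZetaZeroOrder (ρ : ℂ) : ℂ) * ((X : ℂ) ^ (ρ : ℂ) / ((ρ : ℂ) ^ 2 * (ρ + 1)))‖ := by
    refine Summable.of_nonneg_of_le (fun _ ↦ norm_nonneg _) (fun ρ ↦ ?_) hs3n
    have h1 : 1 ≤ ‖(ρ : ℂ) + 1‖ := by
      have := Complex.re_le_norm ((ρ : ℂ) + 1)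
      rw [add_re, one_re] at this
      linarith [re_pos ρ.2]
    have hρ2 : 0 < ‖(ρ : ℂ) ^ 2‖ := norm_pos_iff.2 (pow_ne_zero 2 (ne_zero ρ.2))
    rw [norm_mul, norm_mul, norm_div, norm_div, norm_mul]
    exact mul_le_mul_of_nonneg_left
      (div_le_div_of_nonneg_left (norm_nonneg _) hρ2 (le_mul_of_one_le_right hρ2.le h1)) (norm_nonneg _)
  have hs2 : Summable fun ρ : Zeros ↦ (riemannZetaZeroOrder (ρ : ℂ) : ℂ) * (((X : ℂ) ^ (ρ : ℂ) - 1) / ((ρ : ℂ) ^ 2 * (ρ + 1))) :=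
    (hs5n.of_norm.sub hs4).congr fun ρ ↦ by ring
  rw [Zsum, ← tsum_div_const, ← (hs1.hasSum.add hs2.hasSum).tsum_eq, ← (hs3.hasSum.sub hs4.hasSum).tsum_eq]
  refine tsum_congr fun ρ ↦ ?_
  have hρ := ne_zero ρ.2
  have hρ1 := add_one_ne_zero ρ.2
  simp only [zeroTerm]
  rw [Complex.cpow_add _ _ hX0, Complex.cpow_one]
  generalize (X : ℂ) ^ (ρ : ℂ) = w
  field_simp
  ring

/-! ### The remainder `E` -/

/-- `E(t)/t²` is integrable on `(1, X]` (`E` is continuous on `[1, ∞)`). -/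
theorem integrableOn_psiOneRemainder_div_sq (X : ℝ) :
    IntegrableOn (fun t : ℝ ↦ psiOneRemainder t / (t : ℂ) ^ 2) (Ioc 1 X) :=
  ((continuousOn_psiOneRemainder.mono Icc_subset_Ici_self).div (by fun_prop) fun t ht ↦
    pow_ne_zero 2 (Complex.ofReal_ne_zero.2 (by linarith [ht.1]))).integrableOn_Icc.mono_set Ioc_subset_Icc_self

/-- `‖∫_{(1,X]} E(t)/t² dt‖ ≤ 2C` when `‖E(t)‖ ≤ C√t` (`∫₁^X t^{−3/2} = 2(1 − X^{−1/2}) ≤ 2`). -/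
theorem norm_integral_psiOneRemainder_div_sq_le {C X : ℝ} (hC : ∀ x : ℝ, 0 < x → ‖psiOneRemainder x‖ ≤ C * Real.sqrt x)
    (hX : 1 ≤ X) : ‖∫ t in Ioc 1 X, psiOneRemainder t / (t : ℂ) ^ 2‖ ≤ 2 * C := by
  have hC0 : 0 ≤ C := by
    have h := hC 1 one_pos
    rw [Real.sqrt_one, mul_one] at h
    exact (norm_nonneg _).trans h
  have hg : IntegrableOn (fun t : ℝ ↦ C * t ^ (-(3 / 2 : ℝ))) (Ioc 1 X) :=
    ((continuousOn_id.rpow_const fun t ht ↦ Or.inl (by linarith [ht.1] : (t : ℝ) ≠ 0)).integrableOn_Icc.mono_set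
      Ioc_subset_Icc_self).const_mul C
  have hle : ∀ᵐ t ∂volume.restrict (Ioc 1 X), ‖psiOneRemainder t / (t : ℂ) ^ 2‖ ≤ C * t ^ (-(3 / 2 : ℝ)) := by
    refine (ae_restrict_iff' measurableSet_Ioc).2 (ae_of_all _ fun t ht ↦ ?_)
    have ht0 : 0 < t := by linarith [ht.1]
    rw [norm_div, norm_pow, Complex.norm_real, Real.norm_eq_abs, abs_of_pos ht0, div_le_iff₀ (by positivity)]
    calc ‖psiOneRemainder t‖ ≤ C * Real.sqrt t := hC t ht0
      _ = C * t ^ (-(3 / 2 : ℝ)) * t ^ 2 := by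
          rw [Real.sqrt_eq_rpow, show (t ^ 2 : ℝ) = t ^ (2 : ℝ) by norm_cast, mul_assoc, ← Real.rpow_add ht0]; norm_num
  refine (norm_integral_le_of_norm_le hg hle).trans ?_
  rw [MeasureTheory.integral_const_mul, ← intervalIntegral.integral_of_le hX,
    integral_rpow (Or.inr ⟨by norm_num, by rw [uIcc_of_le hX]; exact fun h ↦ by linarith [h.1]⟩)]
  have hX0 : 0 < X := by linarith
  have h1 : 0 ≤ X ^ (-(3 / 2 : ℝ) + 1) := Real.rpow_nonneg hX0.le _
  rw [Real.one_rpow, show (-(3 / 2 : ℝ) + 1) = -(1 / 2) by norm_num] at *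
  have : (X ^ (-(1 / 2) : ℝ) - 1) / (-(1 / 2) : ℝ) = 2 * (1 - X ^ (-(1 / 2) : ℝ)) := by ring
  rw [this]
  nlinarith

/-! ### Assembly -/

/-- Real part of an integral of a complex function of a real variable. -/
theorem re_setIntegral_eq {f : ℝ → ℂ} {s : Set ℝ} (hf : IntegrableOn f s) :
    (∫ t in s, f t).re = ∫ t in s, (f t).re := by
  have h := integral_re hf
  simp only [RCLike.re_to_complex] at h
  exact h.symm

/-- `∫_{(1,X]} ψ₁(t)/t² dt = (X − 1)/2 + ∫_{(1,X]} R₁(t)/t² dt` (`ψ₁ = t²/2 + R₁`). -/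
theorem integral_psiOne_div_sq {X : ℝ} (hX : 1 ≤ X) :
    ∫ t in Ioc 1 X, psiOne t / t ^ 2 = (X - 1) / 2 + ∫ t in Ioc 1 X, Rone t / t ^ 2 := by
  have hR : IntegrableOn (fun t : ℝ ↦ Rone t / t ^ 2) (Ioc 1 X) :=
    (continuous_Rone.continuousOn.div (continuousOn_pow 2) fun t ht ↦ pow_ne_zero 2 (by linarith [ht.1])).integrableOn_Icc.mono_set
      Ioc_subset_Icc_self
  have heq : EqOn (fun t : ℝ ↦ psiOne t / t ^ 2) (fun t ↦ (1 / 2 : ℝ) + Rone t / t ^ 2) (Ioc 1 X) := by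
    intro t ht
    have ht0 : t ≠ 0 := by linarith [ht.1]
    simp only [Rone]
    field_simp
    ring
  have hc : IntegrableOn (fun _ : ℝ ↦ (1 / 2 : ℝ)) (Ioc 1 X) := integrableOn_const (by simp)
  rw [setIntegral_congr_fun measurableSet_Ioc heq, MeasureTheory.integral_add hc hR, setIntegral_const, smul_eq_mul,
    measureReal_def, Real.volume_Ioc, ENNReal.toReal_ofReal (by linarith)]
  ring

/-- `∫_{(1,X]} R₁(t)/t² dt = −Re ∫_{(1,X]} Z(t)/t² − (log 2π) log X + Re ∫_{(1,X]} E(t)/t²`. -/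
theorem integral_Rone_div_sq {X : ℝ} (hX : 1 ≤ X) :
    ∫ t in Ioc 1 X, Rone t / t ^ 2
      = -(∫ t in Ioc 1 X, Zsum t / (t : ℂ) ^ 2).re - Real.log (2 * π) * Real.log X
        + (∫ t in Ioc 1 X, psiOneRemainder t / (t : ℂ) ^ 2).re := by
  have hZ : IntegrableOn (fun t : ℝ ↦ Zsum t / (t : ℂ) ^ 2) (Ioc 1 X) :=
    ((continuousOn_Zsum_Icc X).div (by fun_prop) fun t ht ↦
      pow_ne_zero 2 (Complex.ofReal_ne_zero.2 (by linarith [ht.1]))).integrableOn_Icc.mono_set Ioc_subset_Icc_self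
  have hE := integrableOn_psiOneRemainder_div_sq X
  have hinv : IntegrableOn (fun t : ℝ ↦ t⁻¹) (Ioc 1 X) :=
    ((continuousOn_inv₀.mono fun t ht ↦ by simp only [mem_compl_iff, mem_singleton_iff]; linarith [ht.1]).integrableOn_Icc
      (a := 1) (b := X)).mono_set Ioc_subset_Icc_self
  have hre : ∀ (z : ℂ) (t : ℝ), (z / (t : ℂ) ^ 2).re = z.re / t ^ 2 := fun z t ↦ by
    rw [← Complex.ofReal_pow, Complex.div_ofReal_re]
  have heq : EqOn (fun t : ℝ ↦ Rone t / t ^ 2)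
      (fun t ↦ -(Zsum t / (t : ℂ) ^ 2).re - Real.log (2 * π) * t⁻¹ + (psiOneRemainder t / (t : ℂ) ^ 2).re) (Ioc 1 X) := by
    intro t ht
    have ht0 : t ≠ 0 := by linarith [ht.1]
    simp only [hre]
    rw [Rone_eq_re ht.1.le]
    field_simp
  have i1 : Integrable (fun t : ℝ ↦ -(Zsum t / (t : ℂ) ^ 2).re) (volume.restrict (Ioc 1 X)) := hZ.re.neg
  have i2 : Integrable (fun t : ℝ ↦ Real.log (2 * π) * t⁻¹) (volume.restrict (Ioc 1 X)) := hinv.const_mul _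
  have i12 : Integrable (fun t : ℝ ↦ -(Zsum t / (t : ℂ) ^ 2).re - Real.log (2 * π) * t⁻¹) (volume.restrict (Ioc 1 X)) :=
    i1.sub i2
  have i3 : Integrable (fun t : ℝ ↦ (psiOneRemainder t / (t : ℂ) ^ 2).re) (volume.restrict (Ioc 1 X)) := hE.re
  have i1' : Integrable (fun t : ℝ ↦ (Zsum t / (t : ℂ) ^ 2).re) (volume.restrict (Ioc 1 X)) := hZ.re
  have hlog : ∫ t in Ioc 1 X, t⁻¹ = Real.log X := by
    rw [← intervalIntegral.integral_of_le hX, integral_inv (by rw [uIcc_of_le hX]; exact fun h ↦ by linarith [h.1]), div_one]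
  rw [setIntegral_congr_fun measurableSet_Ioc heq, MeasureTheory.integral_add i12 i3, MeasureTheory.integral_sub i1 i2,
    MeasureTheory.integral_neg, MeasureTheory.integral_const_mul, ← re_setIntegral_eq hZ, ← re_setIntegral_eq hE, hlog]

/-- **The explicit formula for the logarithmic Riesz mean** (UNCONDITIONAL; `X ≥ 1`):
`W(X) = ∫₁^X ψ(t)dt/t = X − Re Σ_ρ m(ρ)X^ρ/ρ² − (log 2π) log X + c₀ + r(X)`, with the absolutely convergent sum over the
non-trivial zeros of `ζ` (multiplicity `m(ρ)`), `c₀ = −½ − log 2π + Re Σ_ρ m(ρ)/(ρ²(ρ+1))` and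
`r(X) = Re E(X)/X + Re ∫₁^X E(t)dt/t²`, `E` the remainder of the explicit formula for `ψ₁` (`‖E(x)‖ ≤ C√x`). -/
theorem logRiesz_explicit {X : ℝ} (hX : 1 ≤ X) :
    ∫ t in Ioc 1 X, t⁻¹ * ψ t
      = X - (∑' ρ : Zeros, (riemannZetaZeroOrder (ρ : ℂ) : ℂ) * ((X : ℂ) ^ (ρ : ℂ) / (ρ : ℂ) ^ 2)).re
        - Real.log (2 * π) * Real.log X
        + (-1 / 2 - Real.log (2 * π) + (∑' ρ : Zeros, (riemannZetaZeroOrder (ρ : ℂ) : ℂ) / ((ρ : ℂ) ^ 2 * (ρ + 1))).re)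
        + ((psiOneRemainder X).re / X + (∫ t in Ioc 1 X, psiOneRemainder t / (t : ℂ) ^ 2).re) := by
  have hX0 : X ≠ 0 := by linarith
  rw [logRiesz_eq_psiOne hX, integral_psiOne_div_sq hX, integral_Rone_div_sq hX, integral_Zsum_div_sq hX,
    show psiOne X = X ^ 2 / 2 + Rone X by simp [Rone], Rone_eq_re hX]
  have hcomb := congrArg Complex.re (Zsum_div_add_tsum hX)
  rw [add_re, sub_re, Complex.div_ofReal_re] at hcomb
  have e1 : (X ^ 2 / 2 + (-(Zsum X).re - X * Real.log (2 * π) + (psiOneRemainder X).re)) / X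
      = X / 2 - (Zsum X).re / X - Real.log (2 * π) + (psiOneRemainder X).re / X := by
    field_simp
    ring
  rw [e1]
  linarith

/-- **The explicit formula for `W`, bounded form** (UNCONDITIONAL): there is `C` with
`|W(X) − X + Re Σ_ρ m(ρ)X^ρ/ρ² + (log 2π) log X| ≤ C` for all `X ≥ 1`. -/
theorem exists_abs_logRiesz_sub_le :
    ∃ C : ℝ, ∀ X : ℝ, 1 ≤ X →
      |(∫ t in Ioc 1 X, t⁻¹ * ψ t) - X
        + (∑' ρ : Zeros, (riemannZetaZeroOrder (ρ : ℂ) : ℂ) * ((X : ℂ) ^ (ρ : ℂ) / (ρ : ℂ) ^ 2)).re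
        + Real.log (2 * π) * Real.log X| ≤ C := by
  obtain ⟨C, hC0, hC⟩ := exists_norm_psiOneRemainder_le
  refine ⟨|(-1 / 2 - Real.log (2 * π) + (∑' ρ : Zeros, (riemannZetaZeroOrder (ρ : ℂ) : ℂ) / ((ρ : ℂ) ^ 2 * (ρ + 1))).re)|
    + (C + 2 * C), fun X hX ↦ ?_⟩
  have hX0 : 0 < X := by linarith
  rw [logRiesz_explicit hX]
  have h1 : |(psiOneRemainder X).re / X| ≤ C := by
    rw [abs_div, abs_of_pos hX0, div_le_iff₀ hX0]
    calc |(psiOneRemainder X).re| ≤ ‖psiOneRemainder X‖ := Complex.abs_re_le_norm _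
      _ ≤ C * Real.sqrt X := hC X hX0
      _ ≤ C * X := mul_le_mul_of_nonneg_left (by
          rw [Real.sqrt_le_left hX0.le]
          nlinarith) hC0.le
  have h2 : |(∫ t in Ioc 1 X, psiOneRemainder t / (t : ℂ) ^ 2).re| ≤ 2 * C :=
    (Complex.abs_re_le_norm _).trans (norm_integral_psiOneRemainder_div_sq_le hC hX)
  set A := -1 / 2 - Real.log (2 * π) + (∑' ρ : Zeros, (riemannZetaZeroOrder (ρ : ℂ) : ℂ) / ((ρ : ℂ) ^ 2 * (ρ + 1))).re
  set S := (∑' ρ : Zeros, (riemannZetaZeroOrder (ρ : ℂ) : ℂ) * ((X : ℂ) ^ (ρ : ℂ) / (ρ : ℂ) ^ 2)).re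
  set r := (psiOneRemainder X).re / X + (∫ t in Ioc 1 X, psiOneRemainder t / (t : ℂ) ^ 2).re
  have hr : |r| ≤ C + 2 * C := (abs_add_le _ _).trans (add_le_add h1 h2)
  have e : X - S - Real.log (2 * π) * Real.log X + A + r - X + S + Real.log (2 * π) * Real.log X = A + r := by ring
  rw [e]
  linarith [abs_add_le A r]

end LogRieszExplicit

end Summit.RiemannHypothesis.RiemannHypothesis.Theorems.WeilFormatC
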